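import Summits.SmoothPoincare4.SmoothPoincare4.Theses.SymplecticOrigami

/-!
# `OrigamiFoldExistence` — negative-side support: the load-bearing hypothesis

The crux `Summit.SmoothPoincare4.SmoothPoincare4.Theses.SymplecticOrigami.OrigamiFoldExistence`
(stmt-SmoothPoincare4-7844) has exactly ONE hypothesis on the manifold `M` beyond its smooth
ℝ⁴-atlas: the homotopy equivalence `M ≃ₕ S⁴`. Deleting it gives a FALSE statement
(`not_crux_without_homotopyEquiv`), written out inline (no new named `Prop`). Lean witness: the
empty 4-manifold `PEmpty` (the two pieces `V i` must be nonempty) — a junk instance testing only the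
nonemptiness consequence of `M ≃ₕ S⁴`. Honest witnesses, not yet constructible in the tree, test
the other consequences: `S⁴ ⊔ S⁴` (connectedness: the connected fold `Z` lies in one component, the
other component is a compact open piece of some `V i`, and its image under the blow-down `β i` would
be clopen in the connected closed piece `N i` yet miss the symplectic surface `b i (S i) ≠ ∅`) — landed
as `Negative.Disconnected` (p74343); `ℝℙ⁴` (orientability: the typed data force a coorientable fold
with the two pieces on opposite sides, hence `w₁(M) = 0` — paper theorem `FoldDataForcesOrientable`
of the work file `Cruxes/OrigamiFoldExistence/Disproof.lean` §1.3); `#2(S¹ × S³)` (closed orientable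
spin with `b₂ = 0` is still not enough: on a closed oriented `M` with `H₂(M; ℚ) = 0` the pieces are
`b⁺ = 1` symplectic manifolds with `b₂ ≤ 2`, and McDuff / Liu / adjunction exclude every case —
work file §1.6); and, modulo the door item `NoGenusTwoDoor`, Kervaire's homology 4-spheres with
`π₁ ≠ 1` (the rung argument uses only `H₁ = H₂ = 0`).  So, modulo D, any proof of the crux must use
`π₁(M) = 1` itself.  CORRECTION (cycle 2) of the first version of this docstring: `ℝ⁴` is NOT a
witness for compactness — the typing does not make the fold `Z` compact, and `ℝ⁴ = S⁴ ∖ {p}` (`p` on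
the equator) carries the typed data (half-spaces glued along a flat `ℝ³`, pieces still `ℂℙ² ⊃ line`).
What DOES fold: `ℂℙ²` (`= (ℂℙ² ∖ ν line) ∪ (ν line)`, unfolding to `ℂℙ² ⊔ ℂℙ² # ℂℙ²bar`), `T⁴`
(unfolding to `T⁴ ⊔ T² × S²`), every closed symplectic 4-manifold, `X # Y` and `X # Ȳ` for `X, Y`
symplectic or `S⁴` (the typed data impose no coherence on the seam), see the work file §4.
-/

noncomputable section

-- the prescribed namespace `Summit.<P>.<Sub>.…` duplicates `SmoothPoincare4` (P = Sub)
set_option linter.dupNamespace false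

open scoped Manifold ContDiff Topology ContinuousMap
open Set Function

namespace Summit.SmoothPoincare4.SmoothPoincare4.Theorems.OrigamiFoldExistence.Negative

open Summit.SmoothPoincare4.SmoothPoincare4.Theses.SymplecticOrigami

/-- **The homotopy equivalence is load-bearing**: the crux `OrigamiFoldExistence` with its
hypothesis `M ≃ₕ S⁴` deleted is false — the empty smooth 4-manifold (`PEmpty` with Mathlib's
`ChartedSpace.empty` / `IsManifold.empty`) carries no fold data, since the pieces `V i` are
required nonempty. [folklore] -/
theorem not_crux_without_homotopyEquiv : ¬ (∀ (M : Type) [TopologicalSpace M] [T2Space M] [SecondCountableTopology M] [ChartedSpace (EuclideanSpace ℝ (Fin 4)) M] [IsManifold (𝓡 4) ∞ M], ∃ (V : Fin 2 → TopologicalSpace.Opens M) (N : Fin 2 → Type) (_ : ∀ i, TopologicalSpace (N i)) (_ : ∀ i, T2Space (N i)) (_ : ∀ i, SecondCountableTopology (N i)) (_ : ∀ i, CompactSpace (N i)) (_ : ∀ i, ConnectedSpace (N i)) (_ : ∀ i, ChartedSpace (EuclideanSpace ℝ (Fin 4)) (N i)) (_ : ∀ i, IsManifold (𝓡 4) ∞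 (N i)) (s : ∀ i, Literature.Geometry.Kaehler.MForm (𝓡 4) (N i) ℝ 2) (S : Fin 2 → Type) (_ : ∀ i, TopologicalSpace (S i)) (_ : ∀ i, CompactSpace (S i)) (_ : ∀ i, ConnectedSpace (S i)) (_ : ∀ i, ChartedSpace (EuclideanSpace ℝ (Fin 2)) (S i)) (_ : ∀ i, IsManifold (𝓡 2) ∞ (S i)) (b : ∀ i, S i → N i) (β : ∀ i, M → N i), (Disjoint (V 0) (V 1) ∧ (∀ i, (V i : Set M).Nonempty) ∧ IsConnected ((V 0 : Set M) ∪ (V 1 : Set M))ᶜ ∧ (∃ (Z : Type) (_ : TopologicalSpace Z) (_ : ChartedSpace (EuclideanSpace ℝ (Fin 3)) Z) (_ : IsManifold (𝓡 3) ∞ Z) (z : Z → M), Manifold.IsSmoothEmbedding (𝓡 3) (𝓡 4) ∞ z ∧ Set.range z = ((V 0 : Set M) ∪ (V 1 : Set M))ᶜ)) ∧ (∀ i, Literature.Geometry.Kaehler.IsSmoothForm (s i) ∧ Literature.Geometry.Kaehler.IsClosedForm (s i) ∧ (∀ x (v : TangentSpace (𝓡 4) x), v ≠ 0 → ∃ w,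 s i x ![v, w] ≠ 0) ∧ Manifold.IsSmoothEmbedding (𝓡 2) (𝓡 4) ∞ (b i) ∧ (∀ y (v : TangentSpace (𝓡 2) y), v ≠ 0 → ∃ w : TangentSpace (𝓡 2) y, s i (b i y) ![mfderiv (𝓡 2) (𝓡 4) (b i) y v, mfderiv (𝓡 2) (𝓡 4) (b i) y w] ≠ 0) ∧ (∃ U : Set M, IsOpen U ∧ closure (V i : Set M) ⊆ U ∧ ContMDiffOn (𝓡 4) (𝓡 4) ∞ (β i) U) ∧ Set.InjOn (β i) (V i : Set M) ∧ β i '' (V i : Set M) = (Set.range (b i))ᶜ ∧ (∀ x ∈ (V i : Set M), Function.Bijective (mfderiv (𝓡 4) (𝓡 4) (β i) x)) ∧ β i '' frontier (V i : Set M) ⊆ Set.range (b i) ∧ (∀ x ∈ frontier (V i : Set M), Module.finrank ℝ (LinearMap.ker (mfderiv (𝓡 4) (𝓡 4) (β i) x).toLinearMap) = 1))) := by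
  intro h
  letI : ChartedSpace (EuclideanSpace ℝ (Fin 4)) PEmpty.{1} := ChartedSpace.empty _ _
  obtain ⟨V, -, -, -, -, -, -, -, -, -, -, -, -, -, -, -, -, -, ⟨-, hne, -, -⟩, -⟩ := h PEmpty
  obtain ⟨x, -⟩ := hne 0
  exact x.elim

/-- **The crux is its hypothesis-free variant guarded by `M ≃ₕ S⁴`** (sanity: the deleted
hypothesis is the only one) — so `not_crux_without_homotopyEquiv` says every proof of
`OrigamiFoldExistence` must use the homotopy equivalence, and by the paper witnesses above must
use at least nonemptiness, connectedness and compactness of `M`. [folklore] -/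
theorem crux_iff_forall_homotopyEquiv : OrigamiFoldExistence ↔ (∀ (M : Type) [TopologicalSpace M] [T2Space M] [SecondCountableTopology M] [ChartedSpace (EuclideanSpace ℝ (Fin 4)) M] [IsManifold (𝓡 4) ∞ M], Nonempty (M ≃ₕ Metric.sphere (0 : EuclideanSpace ℝ (Fin 5)) 1) → ∃ (V : Fin 2 → TopologicalSpace.Opens M) (N : Fin 2 → Type) (_ : ∀ i, TopologicalSpace (N i)) (_ : ∀ i, T2Space (N i)) (_ : ∀ i, SecondCountableTopology (N i)) (_ : ∀ i, CompactSpace (N i)) (_ : ∀ i, ConnectedSpace (N i)) (_ : ∀ i, ChartedSpace (EuclideanSpace ℝ (Fin 4)) (N i)) (_ : ∀ i, IsManifold (𝓡 4) ∞ (N i)) (s : ∀ i, Literature.Geometry.Kaehler.MForm (𝓡 4) (N i) ℝ 2) (S : Fin 2 → Type) (_ : ∀ i, TopologicalSpace (S i)) (_ : ∀ i, CompactSpace (S i)) (_ : ∀ i, ConnectedSpace (S i)) (_ : ∀ i, ChartedSpace (EuclideanSpace ℝ (Fin 2)) (S i)) (_ : ∀ i, IsManifold (𝓡 2) ∞ (S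 i)) (b : ∀ i, S i → N i) (β : ∀ i, M → N i), (Disjoint (V 0) (V 1) ∧ (∀ i, (V i : Set M).Nonempty) ∧ IsConnected ((V 0 : Set M) ∪ (V 1 : Set M))ᶜ ∧ (∃ (Z : Type) (_ : TopologicalSpace Z) (_ : ChartedSpace (EuclideanSpace ℝ (Fin 3)) Z) (_ : IsManifold (𝓡 3) ∞ Z) (z : Z → M), Manifold.IsSmoothEmbedding (𝓡 3) (𝓡 4) ∞ z ∧ Set.range z = ((V 0 : Set M) ∪ (V 1 : Set M))ᶜ)) ∧ (∀ i, Literature.Geometry.Kaehler.IsSmoothForm (s i) ∧ Literature.Geometry.Kaehler.IsClosedForm (s i) ∧ (∀ x (v : TangentSpace (𝓡 4) x), v ≠ 0 → ∃ w, s i x ![v, w] ≠ 0) ∧ Manifold.IsSmoothEmbedding (𝓡 2) (𝓡 4) ∞ (b i) ∧ (∀ y (v : TangentSpace (𝓡 2) y), v ≠ 0 → ∃ w : TangentSpace (𝓡 2) y, s i (b i y) ![mfderiv (𝓡 2) (𝓡 4) (b i) y v, mfderiv (𝓡 2) (𝓡 4) (b i) y w] ≠ 0) ∧ (∃ U : Set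 M, IsOpen U ∧ closure (V i : Set M) ⊆ U ∧ ContMDiffOn (𝓡 4) (𝓡 4) ∞ (β i) U) ∧ Set.InjOn (β i) (V i : Set M) ∧ β i '' (V i : Set M) = (Set.range (b i))ᶜ ∧ (∀ x ∈ (V i : Set M), Function.Bijective (mfderiv (𝓡 4) (𝓡 4) (β i) x)) ∧ β i '' frontier (V i : Set M) ⊆ Set.range (b i) ∧ (∀ x ∈ frontier (V i : Set M), Module.finrank ℝ (LinearMap.ker (mfderiv (𝓡 4) (𝓡 4) (β i) x).toLinearMap) = 1))) :=
  ⟨fun h M _ _ _ _ _ ⟨e⟩ => h M e, fun h M _ _ _ _ _ e => h M ⟨e⟩⟩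

end Summit.SmoothPoincare4.SmoothPoincare4.Theorems.OrigamiFoldExistence.Negative

end
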